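import Summits.CriticalPhenomena.PercolationContinuityZ3.Theorems.PercNearOneGluingNoHeavyLowerTailCertEG3
import HarnessLib

/-!
# `NoHeavyLowerTail` (stmt-CriticalPhenomena-4575) — additive gluing for three relays with constant `7/6`

Support file (depth prover nh-dp-blobmono gen 3; `--supports stmt-CriticalPhenomena-4575`).  No definitions, no sorries;
inherits the computational axioms of `…CertEG3` (the certified event-gluing bound `CertEG3.eventGluing_three_le_const`).

The additive (Kozma–Nitzan) form of three-relay gluing, `μ(o ↔ {a,b,c}) − C·t ≤ μ(o ↔ d)` when `μ(x ↮ d) ≤ t` for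
`x = a, b, c`, follows from the event form by `μ(E) ≤ μ(o ↔ d) + μ({o ↮ d} ∩ E)`.  With the certified constant of
`…CertEG3` this gives `C = 7/6`, improving `Theorems.additiveGluing_three_fourThirds` (`C = 4/3`); the open sharp form is
`C = 1` (crux stmt-CriticalPhenomena-4576 at three relays).
-/

noncomputable section

namespace Summit.CriticalPhenomena.PercolationContinuityZ3.Theorems

open MeasureTheory Set Literature.Probability.Percolation
open Literature.Probability.LatticeModels (prodBernoulli)

variable {n : ℕ}

/-- **Additive gluing for three relays with constant `7/6`**: for pairwise distinct `a, b, c, d` and any `o`,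
`μ(o ↔ {a,b,c}) − 7/6 · t ≤ μ(o ↔ d)` whenever `μ{x ↮ d} ≤ t` for `x = a, b, c`.
[cite: KozmaNitzan2024, Conjecture (additive form), Lemma 2] -/
theorem additiveGluing_three_sevenSixths (w : Sym2 (Fin n) → unitInterval) (o a b c d : Fin n) (t : ℝ)
    (hab : a ≠ b) (hac : a ≠ c) (had : a ≠ d) (hbc : b ≠ c) (hbd : b ≠ d) (hcd : c ≠ d)
    (ha : (prodBernoulli w).real (openConn a d : Set (BondConfig (Fin n)))ᶜ ≤ t)
    (hb : (prodBernoulli w).real (openConn b d : Set (BondConfig (Fin n)))ᶜ ≤ t)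
    (hc : (prodBernoulli w).real (openConn c d : Set (BondConfig (Fin n)))ᶜ ≤ t) :
    (prodBernoulli w).real ((openConn o a ∪ openConn o b ∪ openConn o c : Set (BondConfig (Fin n)))) - 7 / 6 * t ≤
      (prodBernoulli w).real (openConn o d : Set (BondConfig (Fin n))) := by
  set μ := prodBernoulli w with hμ
  have key := CertEG3.eventGluing_three_le_const w o a b c d t hab hac had hbc hbd hcd ha hb hc
  have hsplit : μ.real ((openConn o a ∪ openConn o b ∪ openConn o c : Set (BondConfig (Fin n)))) ≤
      μ.real (openConn o d : Set (BondConfig (Fin n))) +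
        μ.real ((openConn o d : Set (BondConfig (Fin n)))ᶜ ∩ (openConn o a ∪ openConn o b ∪ openConn o c)) := by
    calc μ.real ((openConn o a ∪ openConn o b ∪ openConn o c : Set (BondConfig (Fin n))))
        ≤ μ.real ((openConn o d : Set (BondConfig (Fin n))) ∪
            ((openConn o d : Set (BondConfig (Fin n)))ᶜ ∩ (openConn o a ∪ openConn o b ∪ openConn o c))) :=
          measureReal_mono fun ω hω => by
            by_cases h : ω ∈ (openConn o d : Set (BondConfig (Fin n)))
            · exact Or.inl h
            · exact Or.inr ⟨h, hω⟩
      _ ≤ _ := measureReal_union_le _ _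
  linarith

/-- **Event gluing for three relays with constant `7/6`, maximum form**: for pairwise distinct `a, b, c, d` and any `o`,
`μ({o ↮ d} ∩ ({o ↔ a} ∪ {o ↔ b} ∪ {o ↔ c})) ≤ 7/6 · max(μ{a ↮ d}, μ{b ↮ d}, μ{c ↮ d})`. [folklore] -/
theorem eventGluing_three_le_sevenSixths_max (w : Sym2 (Fin n) → unitInterval) (o a b c d : Fin n)
    (hab : a ≠ b) (hac : a ≠ c) (had : a ≠ d) (hbc : b ≠ c) (hbd : b ≠ d) (hcd : c ≠ d) :
    (prodBernoulli w).real ((openConn o d : Set (BondConfig (Fin n)))ᶜ ∩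
        (openConn o a ∪ openConn o b ∪ openConn o c)) ≤
      7 / 6 * max ((prodBernoulli w).real (openConn a d : Set (BondConfig (Fin n)))ᶜ)
        (max ((prodBernoulli w).real (openConn b d : Set (BondConfig (Fin n)))ᶜ)
          ((prodBernoulli w).real (openConn c d : Set (BondConfig (Fin n)))ᶜ)) :=
  CertEG3.eventGluing_three_le_const w o a b c d _ hab hac had hbc hbd hcd (le_max_left _ _)
    ((le_max_left _ _).trans (le_max_right _ _)) ((le_max_right _ _).trans (le_max_right _ _))

end Summit.CriticalPhenomena.PercolationContinuityZ3.Theorems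

end
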